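import Mathlib
import Summits.ValiantsHypothesis.ValiantsHypothesis.Theorems.KPlusLogSqLawWeakLiftingTowerGraftDigitExpansion
import Summits.ValiantsHypothesis.ValiantsHypothesis.Theorems.KPlusLogSqLawWeakLiftingTowerGraftLinDescartes

/-!
# Tower graft line — T1 AT LINEAR STEEPNESS FOR THE FULL ONE-LETTER GRAFT: the digit string pays in Descartes currency

Mechanism file for the line `Cruxes/WeakLifting/Lines/tower_graft.lean` (crux `WeakLifting` = stmt-ValiantsHypothesis-19561; S5
`stub_oneLetterGraftLaw`, S1 `stub_digitExpansion` = the tree's `tower_digitExpansion`, p647968).  NO stub is claimed.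
Companion of `…TowerGraftLinDescartes.lean` (the CORNER graft at lin): here the same bookkeeping for an ARBITRARY far letter.

* `signVariations_digitString_le` — for digits `E₀,…,E_{n−1}` each of `natDegree < D`, the base-`X^D` digit string
  `Σ_{j<n} X^{D·j}·E_j` has `V ≤ Σ_{j<n} V(E_j) + (n − 1)` (the seam lemma `Census.signVariations_add_X_pow_mul_le` iterated). [folklore]
* `card_posRoots_digitString_le` — hence `Z₊(Σ_{j<n} X^{D·j}·E_j) ≤ Σ_{j<n} V(E_j) + (n − 1)`.
* `card_posRoots_graft_le_sum_signVariations_digits` — **THE ONE-LETTER GRAFT AT TOWER-TOP STEEPNESS, DESCARTES FORM** (all sizes `m`,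
  all `K`, ANY far letter `S_top`, any letters — symmetry not needed): with `m·dₗ < D`, `0 < D` and the digits
  `E_j = [T^j] det (G + T·S_top)` of S1, `Z₊(det (G + X^D·S_top)) ≤ Σ_{j ≤ m} V(E_j) + m`: at lin the graft's phantoms are paid by the
  Descartes defects of its `m + 1` digits plus `m` seams.  (Instance-additive shapes «`≤ Σ_j Z₊(E_j) + O(1)`» are dead already for the corner,
  `…TowerGraftCornerPhantoms.not_instanceAdditive_cornerLaw`, kill template #38 — the corner is the far letter `E₀₀`, digits `det G`, `det G₀₀`, 0, ….)

HONEST FRAMING: Descartes bookkeeping on top of S1; nothing on S4/S4b/S5/S5ᴸ, TowerB, `WeakLifting`, Conjecture B, `MatrixDescartes`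
(18050) or `VP ≠ VNP`.  Def-free.  Seat: prover val-sym-lift-p2 g19, `--supports stmt-ValiantsHypothesis-19561`.
-/

-- `Summit.ValiantsHypothesis.ValiantsHypothesis.…` repeats a component by the D-0017 layout
-- (single-conjunct summit), which the `dupNamespace` linter flags; the name is mandated.
set_option linter.dupNamespace false

namespace Summit.ValiantsHypothesis.ValiantsHypothesis.Theorems.KPlusLogSqLaw.TowerGraft

open Polynomial
open scoped BigOperators Polynomial
open Summit.ValiantsHypothesis.ValiantsHypothesis.Theorems.LacunarySymmetroidMatrixDescartes.Census
  (signVariations_add_X_pow_mul_le card_posRoots_le_countP_posRoots)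

section LinDescartesGraft

/-- **digit strings**: `V(Σ_{j<n} X^{D j}·E_j) ≤ Σ_{j<n} V(E_j) + (n − 1)` when every digit has `natDegree < D`. [folklore] -/
theorem signVariations_digitString_le {D : ℕ} (n : ℕ) (E : ℕ → ℝ[X]) (hE : ∀ j, (E j).natDegree < D) :
    (∑ j ∈ Finset.range n, (X : ℝ[X]) ^ (D * j) * E j).signVariations ≤
      ∑ j ∈ Finset.range n, (E j).signVariations + (n - 1) := by
  induction n generalizing E with
  | zero => simp
  | succ n ih =>
    rw [Finset.sum_range_succ', Finset.sum_range_succ' (fun j => (E j).signVariations)]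
    simp only [mul_zero, pow_zero, one_mul]
    have hsplit : (∑ j ∈ Finset.range n, (X : ℝ[X]) ^ (D * (j + 1)) * E (j + 1)) =
        (X : ℝ[X]) ^ D * ∑ j ∈ Finset.range n, (X : ℝ[X]) ^ (D * j) * E (j + 1) := by
      rw [Finset.mul_sum]
      refine Finset.sum_congr rfl fun j _ => ?_
      rw [← mul_assoc, ← pow_add]
      congr 2
      ring
    rw [hsplit, add_comm]
    have h1 := signVariations_add_X_pow_mul_le (E 0) (∑ j ∈ Finset.range n, (X : ℝ[X]) ^ (D * j) * E (j + 1)) (hE 0)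
    have h2 := ih (fun j => E (j + 1)) (fun j => hE (j + 1))
    rcases n with _ | n
    · simp
    · simp only [Nat.add_sub_cancel] at h2 ⊢
      omega

/-- positive roots of a digit string: `Z₊(Σ_{j<n} X^{D j}·E_j) ≤ Σ_{j<n} V(E_j) + (n − 1)`. [folklore] -/
theorem card_posRoots_digitString_le {D : ℕ} (n : ℕ) (E : ℕ → ℝ[X]) (hE : ∀ j, (E j).natDegree < D) :
    ((∑ j ∈ Finset.range n, (X : ℝ[X]) ^ (D * j) * E j).roots.toFinset.filter (fun t => 0 < t)).card ≤
      ∑ j ∈ Finset.range n, (E j).signVariations + (n - 1) :=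
  (card_posRoots_le_countP_posRoots _).trans
    ((roots_countP_pos_le_signVariations _).trans (signVariations_digitString_le n E hE))

/-- **THE ONE-LETTER GRAFT AT TOWER-TOP STEEPNESS, DESCARTES FORM.**  For letters `Sₗ` (size `m`, support `d`, `m·dₗ < D`, `0 < D`) and ANY
far letter `S_top`, with the digits `E_j = [T^j] det (G + T·S_top)` of S1 (`tower_digitExpansion`):
`Z₊(det (G + X^D·S_top)) ≤ Σ_{j ≤ m} V(E_j) + m`. [this work] -/
theorem card_posRoots_graft_le_sum_signVariations_digits (m K D : ℕ) (d : Fin K → ℕ)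
    (S : Fin K → Matrix (Fin m) (Fin m) ℝ) (Stop : Matrix (Fin m) (Fin m) ℝ) (hdD : ∀ l, m * d l < D) (hD : 0 < D) :
    let G : Matrix (Fin m) (Fin m) ℝ[X] := ∑ l, (X : ℝ[X]) ^ d l • (S l).map Polynomial.C
    let Q : Polynomial ℝ[X] := (G.map (C : ℝ[X] →+* Polynomial ℝ[X]) +
      (X : Polynomial ℝ[X]) • Stop.map ((C : ℝ[X] →+* Polynomial ℝ[X]).comp (C : ℝ →+* ℝ[X]))).det
    ((G + (X : ℝ[X]) ^ D • Stop.map Polynomial.C).det.roots.toFinset.filter (fun t => 0 < t)).card ≤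
      ∑ j ∈ Finset.range (m + 1), (Q.coeff j).signVariations + m := by
  intro G Q
  obtain ⟨hexp, hdeg⟩ := tower_digitExpansion m K D d S Stop hdD hD
  have hdeg' : ∀ j, (Q.coeff j).natDegree < D := fun j => by
    rcases hdeg j with h | h
    · exact h
    · rw [h, natDegree_zero]; exact hD
  have h := card_posRoots_digitString_le (D := D) (m + 1) (fun j => Q.coeff j) hdeg'
  rw [Nat.add_sub_cancel] at h
  rw [hexp]
  exact h

end LinDescartesGraft

end Summit.ValiantsHypothesis.ValiantsHypothesis.Theorems.KPlusLogSqLaw.TowerGraft
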